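import Summits.ResolutionOfSingularities.ResolutionOfSingularities.Theorems.FrobeniusClosingPatchingRelPerfectConeDepthLineChartsSides
import Summits.ResolutionOfSingularities.ResolutionOfSingularities.Theorems.FrobeniusClosingPatchingRelPerfectConeDepthVertexFibre
import HarnessLib

/-!
# Crux `PatchingRelPerfect` (stmt-ResolutionOfSingularities-16161), chain W5.2 — rung «r-binary-disc-ℓ»: preliminaries to THE LINE FIBRE THEOREM —
# blowing up the bad line of the binary form `c₁² + b c₁c₂ + a c₂²` (`b² − 4a` a unit): over each point of the line exactly one bad point

[OURS · L1 W5.2 · rung tool] Replaces the role of NO printed item; NOT a statement of the manuscript under review; fact-free,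
any characteristic, any residue field.  AI-written (AI review is weaker than expert review).

`σ : X' → X` a blowing up along `J`; at a point `z` with `J_z = (c₀, c₁, c₂)`, `(c; w)` a regular system of parameters of
`𝒪_{X,z}` (`w` of any length), host `𝓗_z = (c₁² + b c₁c₂ + a c₂²)` with `b² − 4a` a unit, carrier `G_z = (c₀)`, plane sheaves
`P₁_z = (c₁)`, `P₂_z = (c₂)`.  THEN (`line_fibre`): there is a point `z'` over `z` where, in a regular system of parameters
`(c'; w')` of `𝒪_{X',z'}` (`c' = (φc₀, e₁, e₂)`, `w' = φ w`), the exceptional divisor reads `(c'₀)`, the weight-one transforms of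
`P₁, P₂` read `(c'₁), (c'₂)`, the weight-two transform of `𝓗` reads `(c'₁² + b' c'₁c'₂ + a' c'₂²)` with `b'² − 4a'` a unit, and the
transform of `G` is `⊤`; at every OTHER point over `z` the transforms of `𝓗`, the exceptional divisor and the transform of `G` have
simple normal crossings, and one of the transforms of `P₁, P₂` is `⊤` there (the new bad line meets the fibre only at `z'`).

## References
* J. Kollár, *Lectures on Resolution of Singularities* (2007), Def. 3.24, 3.61. [Kollar2007]
* The Stacks Project, Tags 0804, 0BIQ. [StacksProject]
* H. Matsumura, *Commutative Ring Theory*, CUP 1986, Thm. 14.2, Thm. 30.3. [Matsumura1987]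
-/

set_option linter.dupNamespace false

noncomputable section

open CategoryTheory CategoryTheory.Limits AlgebraicGeometry TopologicalSpace IsLocalRing
open Literature.AlgebraicGeometry.Resolution
open Scheme.IdealSheafData
open scoped Pointwise

namespace Summit.ResolutionOfSingularities.ResolutionOfSingularities.Theorems

universe u

namespace ConeDepth

/-! ## The line prime of chart `0` -/

section LinePrime

variable {R : Type u} [CommRing R] [IsRegularLocalRing R] (c : Fin 3 → R) {l : ℕ} (w : Fin l → R)
  (hz : Ideal.span (Set.range (Fin.append c w)) = maximalIdeal R) (hd : (maximalIdeal R).spanFinrank = 3 + l)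

/-- The index set of chart generators surviving the killing of `e₁, e₂` on chart `0` is empty. [folklore] -/
theorem isEmpty_lineKill : IsEmpty {j : Fin 3 // j ≠ (0 : Fin 3) ∧ j ∉ ({1, 2} : Set (Fin 3))} :=
  ⟨fun ⟨j, hj0, hj⟩ => by
    fin_cases j
    · exact hj0 rfl
    all_goals simp at hj⟩

include hz hd in
/-- **The line ideal `(φ c₀, φ w, e₁, e₂)` of chart `0` is maximal**: `B₀` modulo it is the residue field. [cite: StacksProject, Tag 0BIQ] -/
theorem isMaximal_lineIdeal :
    (chartStageIdeal c 0 (Ideal.span (Set.range w)) ({1, 2} : Set (Fin 3))).IsMaximal := by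
  have hsup : Ideal.span (Set.range c) ⊔ Ideal.span (Set.range w) = maximalIdeal R := by
    rw [← hz, ← Ideal.span_union]
    congr 1
    ext t
    simp only [Set.mem_union, Set.mem_range]
    constructor
    · rintro (⟨j, rfl⟩ | ⟨k, rfl⟩)
      · exact ⟨Fin.castAdd l j, by simp⟩
      · exact ⟨Fin.natAdd 3 k, by simp⟩
    · rintro ⟨i, rfl⟩
      induction i using Fin.addCases with
      | left j => exact Or.inl ⟨j, by simp⟩
      | right k => exact Or.inr ⟨k, by simp⟩
  haveI : (Ideal.span (Set.range c) ⊔ Ideal.span (Set.range w)).IsMaximal := by rw [hsup]; exact maximalIdeal.isMaximal R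
  have e1 := chartStageEquiv c 0 (Ideal.span (Set.range w)) ({1, 2} : Set (Fin 3)) (isQuasiRegular_centre c w hz hd) (by simp)
  haveI := isEmpty_lineKill
  have e2 : MvPolynomial {j : Fin 3 // j ≠ (0 : Fin 3) ∧ j ∉ ({1, 2} : Set (Fin 3))}
      (R ⧸ (Ideal.span (Set.range c) ⊔ Ideal.span (Set.range w))) ≃+* R ⧸ (Ideal.span (Set.range c) ⊔ Ideal.span (Set.range w)) :=
    (MvPolynomial.isEmptyAlgEquiv _ _).toRingEquiv
  letI : Field (R ⧸ (Ideal.span (Set.range c) ⊔ Ideal.span (Set.range w))) := Ideal.Quotient.field _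
  refine Ideal.Quotient.maximal_of_isField _ ?_
  exact MulEquiv.isField (Field.toIsField _) (e1.symm.trans e2).toMulEquiv

include hz hd in
/-- The line ideal lies over the maximal ideal. [folklore] -/
theorem comap_lineIdeal :
    (chartStageIdeal c 0 (Ideal.span (Set.range w)) ({1, 2} : Set (Fin 3))).comap (chartBase c 0) = maximalIdeal R := by
  refine ((maximalIdeal.isMaximal R).eq_of_le ?_ ?_).symm
  · exact Ideal.comap_ne_top _ (isMaximal_lineIdeal c w hz hd).ne_top
  · rw [← hz, Ideal.span_le]
    rintro _ ⟨i, rfl⟩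
    rw [SetLike.mem_coe, Ideal.mem_comap]
    induction i using Fin.addCases with
    | left j =>
      rw [Fin.append_left, reesChartBase_apply_eq_mul_chartGen c 0 j]
      fin_cases j
      · exact Ideal.mul_mem_right _ _ (reesChartBase_self_mem_chartStageIdeal c 0 _ _)
      · exact Ideal.mul_mem_left _ _ (chartGen_mem_chartStageIdeal c 0 _ (by simp))
      · exact Ideal.mul_mem_left _ _ (chartGen_mem_chartStageIdeal c 0 _ (by simp))
    | right k =>
      rw [Fin.append_right]
      exact reesChartBase_mem_chartStageIdeal_of_mem c 0 _ (Ideal.subset_span ⟨k, rfl⟩)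

include hz hd in
/-- A prime over `𝔪` containing `e₁, e₂` IS the line ideal. [folklore] -/
theorem eq_lineIdeal (𝔓 : Ideal (chartRing c 0)) [𝔓.IsPrime] (h𝔓 : 𝔓.comap (chartBase c 0) = maximalIdeal R)
    (h1 : chartGen c 0 1 ∈ 𝔓) (h2 : chartGen c 0 2 ∈ 𝔓) :
    𝔓 = chartStageIdeal c 0 (Ideal.span (Set.range w)) ({1, 2} : Set (Fin 3)) := by
  refine ((isMaximal_lineIdeal c w hz hd).eq_of_le (Ideal.IsPrime.ne_top inferInstance) ?_).symm
  rw [chartStageIdeal]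
  refine sup_le (sup_le ?_ ?_) ?_
  · rw [Ideal.span_singleton_le_iff_mem]
    exact chartBase_lineCentre_mem c w hz 0 𝔓 h𝔓 0
  · rw [Ideal.map_le_iff_le_comap, h𝔓, Ideal.span_le]
    rintro _ ⟨k, rfl⟩
    exact lineFree_mem c w hz k
  · rw [Ideal.span_le]
    rintro _ ⟨j, hj, rfl⟩
    simp only [Set.mem_insert_iff, Set.mem_singleton_iff] at hj
    rcases hj with rfl | rfl
    exacts [h1, h2]

/-- The line ideal as a point of `Spec B₀`. [folklore] -/
def linePoint : PrimeSpectrum (chartRing c 0) :=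
  ⟨chartStageIdeal c 0 (Ideal.span (Set.range w)) ({1, 2} : Set (Fin 3)), (isMaximal_lineIdeal c w hz hd).isPrime⟩

end LinePrime

/-! ## Distinctness of the chart elements -/

section Distinct

variable {R : Type u} [CommRing R] [IsRegularLocalRing R] (c : Fin 3 → R) {l : ℕ} (w : Fin l → R)
  (hz : Ideal.span (Set.range (Fin.append c w)) = maximalIdeal R) (hd : (maximalIdeal R).spanFinrank = 3 + l)
  (a b : R) (i : Fin 3)

include hz hd in
/-- `e₀ ≠ φ(c_i)` on a chart `i ≠ 0` (`T₀ ≠ 0` modulo `c_i`). [folklore] -/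
theorem chartGen_zero_ne_chartBase₃ (hi : (0 : Fin 3) ≠ i) : chartGen c i 0 ≠ chartBase c i (c i) := by
  haveI : Nontrivial (R ⧸ Ideal.span (Set.range c)) := (isRegularLocalRing_quot_centre c w hz hd).toIsLocalRing.toNontrivial
  intro h
  have h1 : chartQuotEquiv c i (isQuasiRegular_centre c w hz hd) (MvPolynomial.X ⟨0, hi⟩) = 0 := by
    rw [chartQuotEquiv_apply, chartQuotMap_X, h, Ideal.Quotient.eq_zero_iff_mem]
    exact Ideal.mem_span_singleton_self _
  rw [map_eq_zero_iff _ (chartQuotEquiv c i (isQuasiRegular_centre c w hz hd)).injective] at h1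
  exact MvPolynomial.X_ne_zero _ h1

include hz hd in
/-- `f_i ≠ φ(c_i)` and, on a chart `i ≠ 0`, `f_i ≠ e₀`, from a polynomial representative `F` of `f_i` with `F ≠ 0` and
`∂F/∂T₀ = 0 ≠ 1`. [folklore] -/
theorem hostChart_ne_of_repr (f : chartRing c i) (F : MvPolynomial {j : Fin 3 // j ≠ i} (R ⧸ Ideal.span (Set.range c)))
    (hF0 : F ≠ 0) (hfF : chartQuotEquiv c i (isQuasiRegular_centre c w hz hd) F = Ideal.Quotient.mk _ f)
    (hF : ∀ hi : (0 : Fin 3) ≠ i, MvPolynomial.pderiv ⟨0, hi⟩ F = 0) :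
    f ≠ chartBase c i (c i) ∧ ∀ hi : (0 : Fin 3) ≠ i, f ≠ chartGen c i 0 := by
  classical
  haveI : Nontrivial (R ⧸ Ideal.span (Set.range c)) := (isRegularLocalRing_quot_centre c w hz hd).toIsLocalRing.toNontrivial
  constructor
  · intro h
    rw [h, (Ideal.Quotient.eq_zero_iff_mem).mpr (Ideal.mem_span_singleton_self _),
      map_eq_zero_iff _ (chartQuotEquiv c i (isQuasiRegular_centre c w hz hd)).injective] at hfF
    exact hF0 hfF
  · intro hi h
    have h1 : chartQuotEquiv c i (isQuasiRegular_centre c w hz hd) F =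
        chartQuotEquiv c i (isQuasiRegular_centre c w hz hd) (MvPolynomial.X ⟨0, hi⟩) := by
      rw [hfF, chartQuotEquiv_apply, chartQuotMap_X, h]
    rw [(chartQuotEquiv c i (isQuasiRegular_centre c w hz hd)).injective.eq_iff] at h1
    have h2 := congrArg (MvPolynomial.pderiv (⟨0, hi⟩ : {j : Fin 3 // j ≠ i})) h1
    rw [hF hi, MvPolynomial.pderiv_X_self] at h2
    exact zero_ne_one h2

include hz hd in
/-- The three distinctness facts for the host chart function `f_i = e₁² + b e₁e₂ + a e₂²` (`e_i = 1`). [folklore] -/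
theorem binaryHost_ne :
    (chartGen c i 1 * chartGen c i 1 + chartBase c i b * (chartGen c i 1 * chartGen c i 2) +
        chartBase c i a * (chartGen c i 2 * chartGen c i 2)) ≠ chartBase c i (c i) ∧
      ∀ hi : (0 : Fin 3) ≠ i, (chartGen c i 1 * chartGen c i 1 + chartBase c i b * (chartGen c i 1 * chartGen c i 2) +
        chartBase c i a * (chartGen c i 2 * chartGen c i 2)) ≠ chartGen c i 0 := by
  classical
  haveI : Nontrivial (R ⧸ Ideal.span (Set.range c)) := (isRegularLocalRing_quot_centre c w hz hd).toIsLocalRing.toNontrivial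
  -- the representative `F = T₁T₁ + b̄ T₁T₂ + ā T₂T₂` with `T_i := 1`
  let kv : Fin 3 → MvPolynomial {j : Fin 3 // j ≠ i} (R ⧸ Ideal.span (Set.range c)) := fun j =>
    if h : j = i then 1 else MvPolynomial.X ⟨j, h⟩
  have hkv : ∀ j, chartQuotEquiv c i (isQuasiRegular_centre c w hz hd) (kv j) = Ideal.Quotient.mk _ (chartGen c i j) := by
    intro j
    simp only [kv]
    split_ifs with h
    · subst h; rw [map_one, show chartGen c j j = 1 from chartGen_self c j, map_one]
    · rw [chartQuotEquiv_apply, chartQuotMap_X]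
  have hkv0 : ∀ (hi : (0 : Fin 3) ≠ i) j, MvPolynomial.pderiv (⟨0, hi⟩ : {j : Fin 3 // j ≠ i}) (kv j) = 0 ∨ j = 0 := by
    intro hi j
    by_cases hj : j = 0
    · exact Or.inr hj
    · left
      simp only [kv]
      split_ifs with h
      · exact Derivation.map_one_eq_zero _
      · exact MvPolynomial.pderiv_X_of_ne (fun h' => hj (congrArg Subtype.val h'))
  let F : MvPolynomial {j : Fin 3 // j ≠ i} (R ⧸ Ideal.span (Set.range c)) :=
    kv 1 * kv 1 + MvPolynomial.C (Ideal.Quotient.mk _ b) * (kv 1 * kv 2) + MvPolynomial.C (Ideal.Quotient.mk _ a) * (kv 2 * kv 2)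
  have hfF : chartQuotEquiv c i (isQuasiRegular_centre c w hz hd) F = Ideal.Quotient.mk _
      (chartGen c i 1 * chartGen c i 1 + chartBase c i b * (chartGen c i 1 * chartGen c i 2) +
        chartBase c i a * (chartGen c i 2 * chartGen c i 2)) := by
    simp only [F, map_add, map_mul, hkv, chartQuotEquiv_apply, chartQuotMap_C]
  have hF0 : F ≠ 0 := by
    -- evaluate at `T₁ ↦ 1, T₂ ↦ 0` (whichever of them are variables): the value is `1`
    intro h
    have hv1 : MvPolynomial.eval (fun j : {j : Fin 3 // j ≠ i} => if j.1 = 1 then (1 : R ⧸ Ideal.span (Set.range c)) else 0)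
        (kv 1) = 1 := by
      simp only [kv]; split_ifs with h <;> simp [h]
    have hv2 : MvPolynomial.eval (fun j : {j : Fin 3 // j ≠ i} => if j.1 = 1 then (1 : R ⧸ Ideal.span (Set.range c)) else 0)
        (kv 2) = 0 ∨ (2 : Fin 3) = i := by
      simp only [kv]; split_ifs with h
      · exact Or.inr h
      · left; simp
    rcases hv2 with hv2 | hv2
    · have h' := congrArg (MvPolynomial.eval (fun j : {j : Fin 3 // j ≠ i} =>
        if j.1 = 1 then (1 : R ⧸ Ideal.span (Set.range c)) else 0)) h
      simp only [F, map_add, map_mul, MvPolynomial.eval_C, hv1, hv2, mul_one, mul_zero, add_zero, map_zero] at h'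
      exact one_ne_zero h'
    · -- `i = 2`: evaluate differently: `T₁ ↦ 0` gives the value `ā`… use instead `kv 2 = 1` and `T₁ ↦ t`: coefficient argument
      subst hv2
      have h'' := congrArg (MvPolynomial.eval (fun _ : {j : Fin 3 // j ≠ (2 : Fin 3)} => (0 : R ⧸ Ideal.span (Set.range c)))) h
      have hw1 : MvPolynomial.eval (fun _ : {j : Fin 3 // j ≠ (2 : Fin 3)} => (0 : R ⧸ Ideal.span (Set.range c))) (kv 1) = 0 := by
        simp [kv]
      have hw2 : kv 2 = 1 := by simp [kv]
      simp only [F, hw2, map_add, map_mul, MvPolynomial.eval_C, hw1, mul_zero, zero_add, mul_one, map_zero] at h''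
      -- `ā = 0`; then `F = T₁T₁ + b̄ T₁`, and evaluating `∂²/∂T₁²`-free: evaluate at `T₁ ↦ 1`: `1 + b̄ = 0`, at `T₁ ↦ -1`: `1 - b̄ = 0`
      have e1 := congrArg (MvPolynomial.eval (fun _ : {j : Fin 3 // j ≠ (2 : Fin 3)} => (1 : R ⧸ Ideal.span (Set.range c)))) h
      have e2 := congrArg (MvPolynomial.eval (fun _ : {j : Fin 3 // j ≠ (2 : Fin 3)} => (-1 : R ⧸ Ideal.span (Set.range c)))) h
      have hu1 : MvPolynomial.eval (fun _ : {j : Fin 3 // j ≠ (2 : Fin 3)} => (1 : R ⧸ Ideal.span (Set.range c))) (kv 1) = 1 := by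
        simp [kv]
      have hu2 : MvPolynomial.eval (fun _ : {j : Fin 3 // j ≠ (2 : Fin 3)} => (-1 : R ⧸ Ideal.span (Set.range c))) (kv 1) = -1 := by
        simp [kv]
      simp only [F, hw2, map_add, map_mul, MvPolynomial.eval_C, hu1, hu2, mul_one, map_zero, h'', add_zero,
        mul_neg, neg_neg] at e1 e2
      have : (2 : R ⧸ Ideal.span (Set.range c)) = 0 := by linear_combination e1 + e2
      -- in residue characteristic 2 this is no contradiction; use the discriminant-free fact `F` has `T₁²`-coefficient one instead
      have e3 := congrArg (fun G => Polynomial.coeff (MvPolynomial.eval₂ (Polynomial.C : R ⧸ Ideal.span (Set.range c) →+*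
        Polynomial (R ⧸ Ideal.span (Set.range c))) (fun _ : {j : Fin 3 // j ≠ (2 : Fin 3)} => Polynomial.X) G) 2) h
      have hx1 : MvPolynomial.eval₂ (Polynomial.C : R ⧸ Ideal.span (Set.range c) →+* Polynomial (R ⧸ Ideal.span (Set.range c)))
          (fun _ : {j : Fin 3 // j ≠ (2 : Fin 3)} => Polynomial.X) (kv 1) = Polynomial.X := by simp [kv]
      simp only [F, hw2, MvPolynomial.eval₂_add, MvPolynomial.eval₂_mul, MvPolynomial.eval₂_C, hx1,
        MvPolynomial.eval₂_zero, Polynomial.coeff_zero, Polynomial.coeff_add, Polynomial.coeff_C_mul, Polynomial.coeff_X_mul,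
        Polynomial.coeff_X, Polynomial.coeff_C, mul_one] at e3
      norm_num at e3
  have hpd : ∀ hi : (0 : Fin 3) ≠ i, MvPolynomial.pderiv ⟨0, hi⟩ F = 0 := by
    intro hi
    have k1 : MvPolynomial.pderiv (⟨0, hi⟩ : {j : Fin 3 // j ≠ i}) (kv 1) = 0 :=
      (hkv0 hi 1).resolve_right (by decide)
    have k2 : MvPolynomial.pderiv (⟨0, hi⟩ : {j : Fin 3 // j ≠ i}) (kv 2) = 0 :=
      (hkv0 hi 2).resolve_right (by decide)
    simp only [F, map_add, Derivation.leibniz, k1, k2, MvPolynomial.pderiv_C, smul_zero, add_zero]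
  exact hostChart_ne_of_repr c w hz hd i _ F hF0 hfF hpd

end Distinct

end ConeDepth

end Summit.ResolutionOfSingularities.ResolutionOfSingularities.Theorems

end
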